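import Summits.CriticalPhenomena.PercolationContinuityZ3.Theorems.Transplant.GrigorchukWeightedLength
import Summits.CriticalPhenomena.PercolationContinuityZ3.Theorems.Transplant.GrigorchukLevelTransitive
import Mathlib.Algebra.Order.BigOperators.Group.Finset
import Mathlib.Data.Finset.Max
import HarnessLib

/-!
# THE GROWTH RECURSION of the first Grigorchuk group: with `γ_w(n)` = the number of elements of `𝔊` having a normal form of weighted length `≤ n`,
# `γ_w(n) ≤ 2·(m+1)·γ_w(i)·γ_w(j)` for some `i + j ≤ m = ⌊13(n + 6000)/16⌋`

builds on p205010 (kernel theorem, internal audit signed; external expert review pending) — nothing in this file uses p205010; pure group theory / counting,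
no percolation statement, no node touched.  Lane `prim-bschramm`, seat `prim-bschramm-gen-1` gen 8 (GEN pen; offer O-GR file G2, lead g25 GO 2026-08-28T05:41Z).
DEFINITION LANE (review-queued): the explicit finite lists `listsLe` / `nformsLe` of normal forms, the weighted ball `wball n` (a `Finset (Perm Ray)`), its
cardinality `gammaW n`, and its first-level part `stBall n`; everything else is theorems.  Helper file (`--supports stmt-CriticalPhenomena-4575 --as helper`).
No instance (finiteness is by explicit lists; decidability is classical), no notation; REUSES p590723 (`NForm`, `push`, `nf`), p590401 (`sec`, `eq_of_sec_eq`),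
p593398 (`mem_stabOne_or`) and G1 «GrigorchukWeightedLength» (`NForm.wlen`, `exists_sec_nforms`).  NOTHING about growth RATES is concluded here (that is G3
«GrigorchukSubexponentialGrowth»); nothing about amenability, `θ(p_c)`, or any `@[conjecture]`.

* §1 `listsLe k` ∋ every `L : List BCD` with `|L| ≤ k` (`|listsLe k| ≤ 3^(k+1)`); `nformsLe k` ∋ every normal form with `|L| ≤ k`.
* §2 `wball n := {N.eval : N ∈ nformsLe n, N.wlen ≤ n}` with **`mem_wball : g ∈ wball n ↔ ∃ N, N.eval = g ∧ N.wlen ≤ n`** (`4225·|L| ≤ wlen`), `gammaW n := |wball n|`: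
  monotone, `≥ 1`, `≤ 8·3^(n+1)`, `⊆ 𝔊`; every word `w` evaluates into `wball (wordLW w)` and `wordLW w ≤ 3400·|w|`.
* §3 `stBall n := wball n ∩ St(1)`; **`gammaW n ≤ |stBall n| + |stBall (n+3000)|`** (`g ∉ St(1) ↦ a·g ∈ St(1)`, `push a`, injective).
* §4 **`|stBall n| ≤ (m+1)·γ_w(i)·γ_w(j)` for some `i + j ≤ m = ⌊13(n+3000)/16⌋`**: `g ↦ (φ₀ g, φ₁ g)` is injective on `St(1)` (`eq_of_sec_eq`) and lands in
  `⋃_{i ≤ m} wball i × wball (m − i)` by G1's contraction `exists_sec_nforms`.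
* §5 **`gammaW_recursion`**: `γ_w(n) ≤ 2·(m+1)·γ_w(i)·γ_w(j)`, `i + j ≤ m = ⌊13(n + 6000)/16⌋`.
[cite: Grigorchuk1984, proof of the upper bound (the growth function through the sections)] [cite: Bartholdi1998, Prop. (η-contraction at level one)]
[cite: BartholdiErschler2012, §3.1 (ψ injective, [𝔊 : St(1)] = 2)]
-/

noncomputable section

namespace Summit.CriticalPhenomena.PercolationContinuityZ3.Theorems.Transplant

namespace Grigorchuk

open scoped Classical

/-! ## §1 Explicit finite lists of normal forms -/

/-- All lists of Klein letters of length `≤ k` (an explicit enumeration, with repetitions). [folklore] -/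
def listsLe : ℕ → List (List BCD)
  | 0 => [[]]
  | k + 1 => [] :: (listsLe k).flatMap fun L => [BCD.b :: L, BCD.c :: L, BCD.d :: L]

/-- `listsLe k` contains every list of length `≤ k`. [folklore] -/
theorem mem_listsLe : ∀ (k : ℕ) (L : List BCD), L.length ≤ k → L ∈ listsLe k
  | 0, L, h => by
    have hL : L = [] := List.length_eq_zero_iff.1 (Nat.le_zero.1 h)
    subst hL; simp [listsLe]
  | k + 1, [], _ => by simp [listsLe]
  | k + 1, x :: L, h => by
    have ih := mem_listsLe k L (by simp only [List.length_cons] at h; omega)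
    simp only [listsLe, List.mem_cons, List.mem_flatMap]
    refine Or.inr ⟨L, ih, ?_⟩
    cases x <;> simp

/-- `|listsLe k| ≤ 3^(k+1)` (indeed `2|listsLe k| + 1 = 3^(k+1)`). [folklore] -/
theorem length_listsLe : ∀ k : ℕ, 2 * (listsLe k).length + 1 ≤ 3 ^ (k + 1)
  | 0 => by simp [listsLe]
  | k + 1 => by
    have ih := length_listsLe k
    have h3 : ∀ M : List (List BCD), (M.flatMap fun L => [BCD.b :: L, BCD.c :: L, BCD.d :: L]).length = 3 * M.length := by
      intro M; induction M with
      | nil => rfl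
      | cons L M ihM => rw [List.flatMap_cons, List.length_append, ihM, List.length_cons]; simp; omega
    have hlen : (listsLe (k + 1)).length = 1 + 3 * (listsLe k).length := by
      show ([] :: (listsLe k).flatMap fun L => [BCD.b :: L, BCD.c :: L, BCD.d :: L]).length = _
      rw [List.length_cons, h3]; omega
    rw [hlen, pow_succ]; omega

/-- All normal forms with at most `k` blocks. [folklore] -/
def nformsLe (k : ℕ) : List NForm :=
  (listsLe k).flatMap fun L =>
    [⟨false, L, .e⟩, ⟨false, L, .b⟩, ⟨false, L, .c⟩, ⟨false, L, .d⟩, ⟨true, L, .e⟩, ⟨true, L, .b⟩, ⟨true, L, .c⟩, ⟨true, L, .d⟩]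

/-- `nformsLe k` contains every normal form with `|L| ≤ k`. [folklore] -/
theorem mem_nformsLe (k : ℕ) (N : NForm) (h : N.L.length ≤ k) : N ∈ nformsLe k := by
  rcases N with ⟨p, L, q⟩
  simp only [nformsLe, List.mem_flatMap]
  refine ⟨L, mem_listsLe k L h, ?_⟩
  cases p <;> cases q <;> simp

/-- `|nformsLe k| ≤ 8·3^(k+1)`. [folklore] -/
theorem length_nformsLe (k : ℕ) : (nformsLe k).length ≤ 8 * 3 ^ (k + 1) := by
  have hlen : (nformsLe k).length = 8 * (listsLe k).length := by
    have h8 : ∀ M : List (List BCD), (M.flatMap fun L => [(⟨false, L, .e⟩ : NForm), ⟨false, L, .b⟩, ⟨false, L, .c⟩, ⟨false, L, .d⟩, ⟨true, L, .e⟩,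
        ⟨true, L, .b⟩, ⟨true, L, .c⟩, ⟨true, L, .d⟩]).length = 8 * M.length := by
      intro M; induction M with
      | nil => rfl
      | cons L M ihM => rw [List.flatMap_cons, List.length_append, ihM, List.length_cons]; simp; omega
    exact h8 (listsLe k)
  have := length_listsLe k
  omega

/-! ## §2 The weighted ball and the weighted growth function -/

/-- **The weighted ball**: the elements of `𝔊` having a normal form of weighted length `≤ n` (as a finite set of permutations — finite because each block
weighs `≥ 4225`). [cite: Grigorchuk1984, the growth function] [cite: Bartholdi1998, Prop. (the weighted metric)] -/
def wball (n : ℕ) : Finset (Equiv.Perm Ray) := (((nformsLe n).filter fun N => N.wlen ≤ n).map NForm.eval).toFinset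

/-- **Membership in the weighted ball**: `g ∈ wball n ↔ ∃ N, N.eval = g ∧ N.wlen ≤ n`. [folklore] -/
theorem mem_wball {n : ℕ} {g : Equiv.Perm Ray} : g ∈ wball n ↔ ∃ N : NForm, N.eval = g ∧ N.wlen ≤ n := by
  simp only [wball, List.mem_toFinset, List.mem_map, List.mem_filter, decide_eq_true_eq]
  constructor
  · rintro ⟨N, ⟨-, hN⟩, rfl⟩; exact ⟨N, rfl, hN⟩
  · rintro ⟨N, rfl, hN⟩
    refine ⟨N, ⟨mem_nformsLe n N ?_, hN⟩, rfl⟩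
    have := length_le_wlen N; omega

/-- **The weighted growth function** `γ_w(n) = |wball n|`. [cite: Grigorchuk1984, the growth function] -/
def gammaW (n : ℕ) : ℕ := (wball n).card

/-- `wball` is monotone. [folklore] -/
theorem wball_mono {m n : ℕ} (h : m ≤ n) : wball m ⊆ wball n := fun g hg => by
  rw [mem_wball] at hg ⊢
  obtain ⟨N, e, hN⟩ := hg
  exact ⟨N, e, hN.trans h⟩

/-- `γ_w` is monotone. [folklore] -/
theorem gammaW_mono {m n : ℕ} (h : m ≤ n) : gammaW m ≤ gammaW n := Finset.card_le_card (wball_mono h)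

/-- `1 ∈ wball n`. [folklore] -/
theorem one_mem_wball (n : ℕ) : (1 : Equiv.Perm Ray) ∈ wball n := mem_wball.2 ⟨NForm.one, NForm.eval_one, by simp⟩

/-- `γ_w(n) ≥ 1`. [folklore] -/
theorem gammaW_pos (n : ℕ) : 0 < gammaW n := Finset.card_pos.2 ⟨1, one_mem_wball n⟩

/-- **A crude exponential bound `γ_w(n) ≤ 8·3^(n+1)`** (count of normal forms). [folklore] -/
theorem gammaW_le_pow (n : ℕ) : gammaW n ≤ 8 * 3 ^ (n + 1) := by
  refine (List.toFinset_card_le _).trans ?_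
  rw [List.length_map]
  exact (List.length_filter_le _ _).trans (length_nformsLe n)

/-- The weighted ball lies in `𝔊`. [cite: Grigorchuk1980, definition of the group] -/
theorem mem_grigorchukGroup_of_mem_wball {n : ℕ} {g : Equiv.Perm Ray} (hg : g ∈ wball n) : g ∈ grigorchukGroup := by
  obtain ⟨N, rfl, -⟩ := mem_wball.1 hg
  exact NForm.eval_mem N

/-- **Every word evaluates into the weighted ball of its weighted length** (via its normal form, p590723 `nf`). [cite: Bartholdi1998, Prop. (the weighted metric)] -/
theorem prod_mem_wball (w : List Letter) : (w.map Letter.toPerm).prod ∈ wball (wordLW w) :=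
  mem_wball.2 ⟨nf w, eval_nf w, wlen_nf_le w⟩

/-- `wordLW w ≤ 3400·|w|` (the heaviest letter is `b`). [folklore] -/
theorem wordLW_le (w : List Letter) : wordLW w ≤ 3400 * w.length := by
  induction w with
  | nil => simp
  | cons ℓ w ih =>
    have hℓ : ℓ.lw ≤ 3400 := by rcases ℓ with _ | ⟨_ | _ | _⟩ <;> decide
    rw [wordLW_cons, List.length_cons]; omega

/-! ## §3 The first-level part; the non-`St(1)` half injects into it -/

/-- The `St(1)`-part of the weighted ball. [cite: BartholdiErschler2012, §3.1] -/
def stBall (n : ℕ) : Finset (Equiv.Perm Ray) := (wball n).filter fun g => g ∈ stabOne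

/-- Membership in `stBall n`. [folklore] -/
theorem mem_stBall {n : ℕ} {g : Equiv.Perm Ray} : g ∈ stBall n ↔ g ∈ wball n ∧ g ∈ stabOne := Finset.mem_filter

/-- `stBall` is monotone. [folklore] -/
theorem stBall_mono {m n : ℕ} (h : m ≤ n) : stBall m ⊆ stBall n := Finset.filter_subset_filter _ (wball_mono h)

/-- For `g ∈ 𝔊 ∖ St(1)`, `a·g ∈ St(1)` (`[𝔊 : St(1)] = 2`). [cite: BartholdiErschler2012, §3.1 ([𝔊 : St(1)] = 2)] -/
theorem genA_mul_mem_stabOne {g : Equiv.Perm Ray} (hg : g ∈ grigorchukGroup) (hns : g ∉ stabOne) : genA * g ∈ stabOne := by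
  rcases mem_stabOne_or hg with ⟨h, -⟩ | ⟨h, -⟩
  · exact absurd h hns
  · have e : genA * g = genA * (g * genA) * genA := by
      rw [mul_assoc, mul_assoc, show genA * genA = 1 from Equiv.ext fun x => flipAt_involutive 0 x, mul_one]
    rw [e]; exact conj_genA_mem_stabOne h

/-- **`γ_w(n) ≤ |stBall n| + |stBall (n + 3000)|`**: the non-`St(1)` elements of `wball n` inject, by `g ↦ a·g` (`push a`, one more letter of weight `3000`), into
`stBall (n + 3000)`. [cite: Grigorchuk1984, proof of the upper bound] -/
theorem gammaW_le_card_stBall (n : ℕ) : gammaW n ≤ (stBall n).card + (stBall (n + 3000)).card := by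
  have hsplit := Finset.card_filter_add_card_filter_not (s := wball n) (fun g => g ∈ stabOne)
  have hinj : ((wball n).filter fun g => ¬ g ∈ stabOne).card ≤ (stBall (n + 3000)).card := by
    refine Finset.card_le_card_of_injOn (fun g => genA * g) (fun g hg => ?_) (fun g _ g' _ h => mul_left_cancel h)
    rw [Finset.mem_coe, Finset.mem_filter] at hg
    obtain ⟨hgw, hgs⟩ := hg
    obtain ⟨N, rfl, hN⟩ := mem_wball.1 hgw
    rw [Finset.mem_coe]
    refine mem_stBall.2 ⟨mem_wball.2 ⟨push .a N, eval_push .a N, ?_⟩, genA_mul_mem_stabOne (NForm.eval_mem N) hgs⟩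
    have := wlen_push_le .a N
    simp only [Letter.lw] at this; omega
  unfold gammaW
  rw [← hsplit]
  exact Nat.add_le_add_left hinj _

/-! ## §4 The `St(1)`-part through the sections -/

/-- The section pair of a permutation (junk `(1,1)` outside `St(1)`). [cite: BartholdiErschler2012, §3.1 (ψ = (φ₀, φ₁))] -/
theorem exists_secPair_injOn_bound (n : ℕ) :
    (stBall n).card ≤ ∑ i ∈ Finset.range (13 * (n + 3000) / 16 + 1), gammaW i * gammaW (13 * (n + 3000) / 16 - i) := by
  set m : ℕ := 13 * (n + 3000) / 16 with hm
  -- the section-pair map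
  let f : Equiv.Perm Ray → Equiv.Perm Ray × Equiv.Perm Ray := fun g =>
    if h : g ∈ stabOne then (sec false ⟨g, h⟩, sec true ⟨g, h⟩) else (1, 1)
  let T : Finset (Equiv.Perm Ray × Equiv.Perm Ray) := (Finset.range (m + 1)).biUnion fun i => wball i ×ˢ wball (m - i)
  have hmap : Set.MapsTo f ↑(stBall n) ↑T := by
    intro g hg
    rw [Finset.mem_coe, mem_stBall] at hg
    rw [Finset.mem_coe]
    obtain ⟨hgw, hgs⟩ := hg
    obtain ⟨N, hNg, hN⟩ := mem_wball.1 hgw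
    have hNs : N.eval ∈ stabOne := by rw [hNg]; exact hgs
    obtain ⟨N₀, N₁, h0, h1, hw⟩ := exists_sec_nforms N hNs
    have hsum : N₀.wlen + N₁.wlen ≤ m := by
      rw [hm, Nat.le_div_iff_mul_le (by norm_num)]
      have : 13 * (N.wlen + 3000) ≤ 13 * (n + 3000) := by omega
      omega
    have hf : f g = (sec false ⟨N.eval, hNs⟩, sec true ⟨N.eval, hNs⟩) := by
      simp only [f, dif_pos hgs]
      subst hNg; rfl
    rw [hf, Finset.mem_biUnion]
    refine ⟨N₀.wlen, Finset.mem_range.2 (by omega), Finset.mem_product.2 ⟨mem_wball.2 ⟨N₀, h0, le_rfl⟩, mem_wball.2 ⟨N₁, h1, by omega⟩⟩⟩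
  have hinj : Set.InjOn f (stBall n : Set (Equiv.Perm Ray)) := by
    intro g hg g' hg' e
    rw [Finset.mem_coe, mem_stBall] at hg hg'
    simp only [f, dif_pos hg.2, dif_pos hg'.2, Prod.mk.injEq] at e
    exact congrArg Subtype.val (eq_of_sec_eq e.1 e.2)
  calc (stBall n).card ≤ T.card := Finset.card_le_card_of_injOn f hmap hinj
    _ ≤ ∑ i ∈ Finset.range (m + 1), (wball i ×ˢ wball (m - i)).card := Finset.card_biUnion_le
    _ = ∑ i ∈ Finset.range (m + 1), gammaW i * gammaW (m - i) := by simp only [Finset.card_product, gammaW]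

/-- **`|stBall n| ≤ (m+1)·γ_w(i)·γ_w(j)` for some `i + j ≤ m = ⌊13(n + 3000)/16⌋`** (the largest term of the sum). [cite: Grigorchuk1984, proof of the upper bound] -/
theorem card_stBall_le (n : ℕ) :
    ∃ i j : ℕ, i + j ≤ 13 * (n + 3000) / 16 ∧ (stBall n).card ≤ (13 * (n + 3000) / 16 + 1) * (gammaW i * gammaW j) := by
  set m : ℕ := 13 * (n + 3000) / 16
  obtain ⟨i₀, hi₀, hmax⟩ := Finset.exists_max_image (Finset.range (m + 1)) (fun i => gammaW i * gammaW (m - i)) ⟨0, by simp⟩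
  refine ⟨i₀, m - i₀, by have := Finset.mem_range.1 hi₀; omega, (exists_secPair_injOn_bound n).trans ?_⟩
  calc ∑ i ∈ Finset.range (m + 1), gammaW i * gammaW (m - i)
      ≤ ∑ _i ∈ Finset.range (m + 1), gammaW i₀ * gammaW (m - i₀) := Finset.sum_le_sum fun i hi => hmax i hi
    _ = (m + 1) * (gammaW i₀ * gammaW (m - i₀)) := by rw [Finset.sum_const, Finset.card_range, smul_eq_mul]

/-! ## §5 The recursion -/

/-- **THE GROWTH RECURSION (Grigorchuk 1984, level-one weighted form): `γ_w(n) ≤ 2·(m+1)·γ_w(i)·γ_w(j)` for some `i + j ≤ m = ⌊13(n + 6000)/16⌋`.**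
[cite: Grigorchuk1984, proof of the upper bound (growth through the sections)] [cite: Bartholdi1998, Prop. (η-contraction at level one)] -/
theorem gammaW_recursion (n : ℕ) :
    ∃ i j : ℕ, i + j ≤ 13 * (n + 6000) / 16 ∧ gammaW n ≤ 2 * (13 * (n + 6000) / 16 + 1) * (gammaW i * gammaW j) := by
  obtain ⟨i, j, hij, hle⟩ := card_stBall_le (n + 3000)
  have hm : 13 * (n + 3000 + 3000) / 16 = 13 * (n + 6000) / 16 := by ring_nf
  rw [hm] at hij hle
  refine ⟨i, j, hij, ?_⟩
  have h1 := gammaW_le_card_stBall n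
  have h2 : (stBall n).card ≤ (stBall (n + 3000)).card := Finset.card_le_card (stBall_mono (by omega))
  calc gammaW n ≤ (stBall n).card + (stBall (n + 3000)).card := h1
    _ ≤ 2 * (stBall (n + 3000)).card := by omega
    _ ≤ 2 * ((13 * (n + 6000) / 16 + 1) * (gammaW i * gammaW j)) := Nat.mul_le_mul_left 2 hle
    _ = 2 * (13 * (n + 6000) / 16 + 1) * (gammaW i * gammaW j) := by ring

end Grigorchuk

end Summit.CriticalPhenomena.PercolationContinuityZ3.Theorems.Transplant

end
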